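import Summits.CriticalPhenomena.PercolationContinuityZ3.Theorems.Transplant.SkelFrmBChoiceCreepYCore
import HarnessLib

/-!
# N2 (frames-only node `SamePDropOfSkeletonFrm₁`, OPEN) — (ζ″) ledger under (R-40)/(R-42): THE PURE-INTEGER CORE OF THE y-STEP CREEP ROWS
# (`NegB.floorA_bounds`, `NegB.creepY_core3`), instantiated at the tuple of record in `SkelFrmBChoiceCreepY3`

The y′-corridor's arrival box read along axis 0 (`rdLo₀/rdHi₀ = ⌊c₀′·⌊A·Z/n⌋/D⌋`, `Z = Δ·x′ − (max/min of the two hop-drift terms)`,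
`c₀′·A·Δ = s₀·D`): `floorA_bounds` turns the two nested floors into `nΔ·F ≤ s₀·Z` and `s₀(Z − n) − nΔ < nΔ·F`; `creepY_core3` is the linear
bookkeeping — with `Ctr2Y = 2(N+1)v − 2v + a₁·n`, `Hw2Y = E₁ + 2a₂(R + |v|)`, rows `lo₁ = (N+1)s + XY − P₀`, `G = U·P₀ + U − 1`, drift residue
`Δ − U·s ∈ [0, 2U]`, `a₁ ∈ [80, 84]`, `a₂ ∈ [1, 42]`, `XY ∈ [0, 22s]`, `E₁ ∈ [2(n+|v|), 5n]`, `N ≤ 21K + 2`, `40KR ≤ s + 1 ≤ n`, `K ≥ 100`, `s ≥ 958` —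
the reading `[Fm, Fp+1]` has width `≤ 152·s₀ − 3`, sum `∈ [−1, 251·s₀]`, `Fm ≥ −2K·s₀`, `Fp + 1 ≤ 2K·s₀`.  No tree objects: pure `ℤ` lemmas.
builds on p205010 (kernel theorem, internal audit signed; external expert review pending) — nothing here uses p205010; NOTHING is claimed about the open node `SamePDropOfSkeletonFrm₁`.
Lane `prim-bschramm`, seat `prim-bschramm-stmt` (gen 21); helper file (`--supports stmt-CriticalPhenomena-4575 --as helper`).
[cite: KozmaNitzan2024, §4 Lemma 12 (pp. 23–25), p. 25 (the renormalised lattice)] [cite: MartineauTassion2017, §4.3 Lemma 4.2]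
-/

namespace Summit.CriticalPhenomena.PercolationContinuityZ3.Theorems.Transplant

namespace PlanarSkeletonFrm

namespace NegB

/-- **The pure-integer core of the y-step creep rows.** Every bound linearised: drift residue `Δ − U·s ∈ [0, 2U]`, phase counts
`a₁ = m₁Y+1 ∈ [194, 198]`, `a₂ = m₂Y+1 ≤ 42`, overhang `XY ≤ 22·sL`, window `E₁ ≤ 5n`, `K ≥ 100`; the two drift terms `T₁, T₂ = T₁ + v·G` enter through
`max/min`; the floors enter as `nΔ·F ≤ s₀·A` and `s₀(A − n) − nΔ < nΔ·F` (`floorA_bounds`). Conclusions = width `≤ 152s₀ − 3`, sum `∈ [−1, 251s₀]`, and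
the `±2K·s₀` rows of the fine-0 reading `[Fm, Fp+1]`. [folklore] -/
theorem creepY_core3
    {n U Δ s K R v av N a₁ a₂ E₁ XY P₀ H C lo₀ hi₀ lo₁ G T₁ T₂ Am Ap s₀ Fm Fp : ℤ}
    (hn : 1 ≤ n) (hUn : n ≤ U) (hUs : U * s ≤ Δ) (hΔU : Δ ≤ U * s + 2 * U) (hs : 958 ≤ s) (hK : 100 ≤ K) (hR : 1 ≤ R)
    (hKR : 40 * K * R ≤ s + 1) (hnR : 40 * K * R + 1 ≤ n)
    (hav0 : 0 ≤ av) (havn : av ≤ n) (hv1 : v ≤ av) (hv2 : -v ≤ av)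
    (hN0 : 0 ≤ N) (hN : N ≤ 21 * K + 2) (ha1 : 194 ≤ a₁) (ha1' : a₁ ≤ 198) (ha2 : 1 ≤ a₂) (ha2' : a₂ ≤ 42)
    (hE0 : 2 * (n + av) ≤ E₁) (hE1 : E₁ ≤ 5 * n) (hXY0 : 0 ≤ XY) (hXY : XY ≤ 22 * s) (hP0 : s ≤ P₀) (hP1 : P₀ ≤ s + 1)
    (hH : H = E₁ + 2 * a₂ * (R + av)) (hC : C = 2 * (N + 1) * v - 2 * v + a₁ * n)
    (hlo0 : C - H ≤ 2 * lo₀) (hlo0' : 2 * lo₀ ≤ C - H + 1) (hhi0 : 2 * hi₀ ≤ C + H) (hhi0' : C + H - 1 ≤ 2 * hi₀)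
    (hlo1 : lo₁ = (N + 1) * s + XY - P₀) (hG : G = U * P₀ + U - 1)
    (hT₁ : T₁ = v * (U * lo₁)) (hT₂ : T₂ = T₁ + v * G) (hAm : Am = Δ * lo₀ - max T₁ T₂) (hAp : Ap = Δ * hi₀ - min T₁ T₂)
    (hs0 : 1 ≤ s₀) (hF1 : n * Δ * Fm ≤ s₀ * Am) (hF2 : s₀ * (Am - n) - n * Δ < n * Δ * Fm) (hF3 : n * Δ * Fp ≤ s₀ * Ap)
    (hF4 : s₀ * (Ap - n) - n * Δ < n * Δ * Fp) :
    Fp + 1 - Fm ≤ 152 * s₀ - 3 ∧ 0 ≤ Fm + (Fp + 1) ∧ Fm + (Fp + 1) ≤ 251 * s₀ + 1 ∧ -(2 * K * s₀) ≤ Fm ∧ Fp + 1 ≤ 2 * K * s₀ := by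
  -- basic positivity
  have hU0 : 0 < U := by linarith
  have hn0 : 0 < n := by linarith
  have hs0p : 0 < s₀ := by linarith
  have hUs958 : 958 * U ≤ U * s := by have := mul_le_mul_of_nonneg_left hs hU0.le; linarith
  have hUΔ : 958 * U ≤ Δ := hUs958.trans hUs
  have hΔ0 : 0 < Δ := by linarith
  have hK40 : 40 * K ≤ s + 1 := by
    have : 40 * K * 1 ≤ 40 * K * R := mul_le_mul_of_nonneg_left hR (by linarith)
    linarith
  have hKU : 40 * (K * U) ≤ Δ + U := by
    have := mul_le_mul_of_nonneg_right hK40 hU0.le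
    linarith
  have hRn : 40 * K * R ≤ n := by linarith
  -- the drift residue `d := Δ − U s ∈ [0, 2U]`
  have hd0 : 0 ≤ Δ - U * s := by linarith
  have hd1 : Δ - U * s ≤ 2 * U := by linarith
  have hvabs : |v| ≤ av := abs_le.2 ⟨by linarith, hv1⟩
  have hvn0 : |v| ≤ n := hvabs.trans havn
  have hG0 : 0 ≤ G := by
    have : U * s ≤ U * P₀ := mul_le_mul_of_nonneg_left hP0 hU0.le
    rw [hG]; linarith
  -- max/min of the two drift terms: `T₂ − T₁ = v·G`, `G ≥ 0`
  have hMd : max T₁ T₂ - min T₁ T₂ ≤ av * G := by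
    rcases le_total T₁ T₂ with h12 | h12
    · rw [max_eq_right h12, min_eq_left h12, hT₂]
      have : v * G ≤ av * G := mul_le_mul_of_nonneg_right hv1 hG0
      linarith
    · rw [max_eq_left h12, min_eq_right h12, hT₂]
      have : -v * G ≤ av * G := mul_le_mul_of_nonneg_right hv2 hG0
      linarith
  have hMs : max T₁ T₂ + min T₁ T₂ = 2 * (v * (U * lo₁)) + v * G := by
    rcases le_total T₁ T₂ with h12 | h12
    · rw [max_eq_right h12, min_eq_left h12, hT₂, hT₁]; ring
    · rw [max_eq_left h12, min_eq_right h12, hT₂, hT₁]; ring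
  generalize max T₁ T₂ = Mp at hMd hMs hAm hAp
  generalize min T₁ T₂ = Mm at hMd hMs hAm hAp
  -- (1) the box coordinates
  have hsum0 : lo₀ + hi₀ = C := by omega
  have hdiff0 : hi₀ - lo₀ ≤ H := by omega
  have ha2R : 0 ≤ a₂ * (R + av) := mul_nonneg (by linarith) (by linarith)
  have hH0 : 0 ≤ H := by rw [hH]; linarith
  have hH1 : H ≤ 89 * n + 84 * R := by
    have : a₂ * (R + av) ≤ 42 * (R + n) := mul_le_mul ha2' (by linarith) (by linarith) (by norm_num)
    rw [hH]; linarith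
  -- (2) width numerator `Ap − Am ≤ Δ·H + av·G ≤ 47·nΔ`
  have hG1 : G ≤ U * s + 2 * U := by
    have : U * P₀ ≤ U * (s + 1) := mul_le_mul_of_nonneg_left hP1 hU0.le
    rw [hG]; linarith
  have hW : Ap - Am ≤ Δ * H + av * G := by
    have : Δ * (hi₀ - lo₀) ≤ Δ * H := mul_le_mul_of_nonneg_left hdiff0 hΔ0.le
    rw [hAp, hAm]; linarith
  have hnΔ : 0 < n * Δ := by positivity
  have hW' : Ap - Am ≤ 92 * (n * Δ) := by
    have h1 : Δ * H ≤ Δ * (89 * n + 84 * R) := mul_le_mul_of_nonneg_left hH1 hΔ0.le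
    have h2 : av * G ≤ n * (U * s + 2 * U) := mul_le_mul havn hG1 hG0 hn0.le
    have h3 : Δ * (40 * K * R) ≤ Δ * n := mul_le_mul_of_nonneg_left hRn hΔ0.le
    have h3' : Δ * R * 84 ≤ Δ * (40 * K * R) := by
      have : 0 ≤ Δ * R * (40 * K - 84) := mul_nonneg (mul_nonneg hΔ0.le (by linarith)) (by linarith)
      linarith
    have h4 : n * (U * s) ≤ n * Δ := mul_le_mul_of_nonneg_left hUs hn0.le
    have h5 : n * (958 * U) ≤ n * Δ := mul_le_mul_of_nonneg_left hUΔ hn0.le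
    linarith
  -- (3) sum numerator
  have hC' : lo₀ + hi₀ = 2 * (N + 1) * v - 2 * v + a₁ * n := by rw [hsum0, hC]
  have hMs' : Mp + Mm = 2 * (v * (U * ((N + 1) * s + XY - P₀))) + v * (U * P₀ + U - 1) := by rw [hMs, hlo1, hG]
  have hSum : Am + Ap = 2 * ((N + 1) * v * (Δ - U * s)) + a₁ * (n * Δ) - 2 * (v * Δ) - 2 * (v * U * XY) + v * U * P₀ - v * U + v := by
    rw [hAm, hAp]; linear_combination Δ * hC' - hMs'
  -- monomial bounds
  have hm1 : |(N + 1) * v * (Δ - U * s)| ≤ (N + 1) * n * (2 * U) := by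
    rw [abs_mul, abs_mul, abs_of_nonneg (by linarith : (0 : ℤ) ≤ N + 1), abs_of_nonneg hd0]
    apply mul_le_mul (mul_le_mul_of_nonneg_left hvn0 (by linarith)) hd1 hd0
    positivity
  have hm1' : (N + 1) * n * (2 * U) ≤ 2 * (n * Δ) := by
    have h1 : (N + 1) * (2 * U) ≤ (21 * K + 3) * (2 * U) := mul_le_mul_of_nonneg_right (by linarith) (by linarith)
    have h2 : (21 * K + 3) * (2 * U) ≤ 2 * Δ := by linarith
    have h3 := mul_le_mul_of_nonneg_left (h1.trans h2) hn0.le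
    linarith
  have hm1abs := abs_le.1 (hm1.trans hm1')
  have hm2 : |v * U * XY| ≤ 22 * (n * Δ) := by
    rw [abs_mul, abs_mul, abs_of_nonneg hU0.le, abs_of_nonneg hXY0]
    have h4 : n * (U * s) ≤ n * Δ := mul_le_mul_of_nonneg_left hUs hn0.le
    calc |v| * U * XY ≤ n * U * (22 * s) := by
          apply mul_le_mul (mul_le_mul_of_nonneg_right hvn0 hU0.le) hXY hXY0 (by positivity)
      _ = 22 * (n * (U * s)) := by ring
      _ ≤ 22 * (n * Δ) := by linarith
  have hm2abs := abs_le.1 hm2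
  have hm3 : |v * U * P₀| ≤ n * Δ + n * U := by
    rw [abs_mul, abs_mul, abs_of_nonneg hU0.le, abs_of_nonneg (by linarith : (0 : ℤ) ≤ P₀)]
    have h4 : n * (U * s) ≤ n * Δ := mul_le_mul_of_nonneg_left hUs hn0.le
    calc |v| * U * P₀ ≤ n * U * (s + 1) := by
          apply mul_le_mul (mul_le_mul_of_nonneg_right hvn0 hU0.le) hP1 (by linarith) (by positivity)
      _ = n * (U * s) + n * U := by ring
      _ ≤ n * Δ + n * U := by linarith
  have hm3abs := abs_le.1 hm3
  have hm4 : |v * Δ| ≤ n * Δ := by rw [abs_mul, abs_of_nonneg hΔ0.le]; exact mul_le_mul_of_nonneg_right hvn0 hΔ0.le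
  have hm4abs := abs_le.1 hm4
  have hm5 : |v * U| ≤ n * U := by rw [abs_mul, abs_of_nonneg hU0.le]; exact mul_le_mul_of_nonneg_right hvn0 hU0.le
  have hm5abs := abs_le.1 hm5
  have hnU : 958 * (n * U) ≤ n * Δ := by have := mul_le_mul_of_nonneg_left hUΔ hn0.le; linarith
  have hvn : |v| ≤ n * Δ := hvn0.trans (le_mul_of_one_le_right hn0.le (by linarith))
  have hvn' := abs_le.1 hvn
  have ha1lo : 194 * (n * Δ) ≤ a₁ * (n * Δ) := mul_le_mul_of_nonneg_right ha1 hnΔ.le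
  have ha1hi : a₁ * (n * Δ) ≤ 198 * (n * Δ) := mul_le_mul_of_nonneg_right ha1' hnΔ.le
  -- sum bounds: `141·nΔ ≤ Am + Ap ≤ 251·nΔ`
  have hSlo : 141 * (n * Δ) ≤ Am + Ap := by rw [hSum]; linarith
  have hShi : Am + Ap ≤ 251 * (n * Δ) := by rw [hSum]; linarith
  -- (4) floors (hypotheses `hF1`–`hF4`)
  have hs0n : s₀ * n ≤ s₀ * (n * Δ) := mul_le_mul_of_nonneg_left (le_mul_of_one_le_right hn0.le (by linarith)) hs0p.le
  have hs0nΔ : n * Δ ≤ s₀ * (n * Δ) := le_mul_of_one_le_left hnΔ.le hs0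
  -- products of s₀ with the A-bounds
  have hW'' : s₀ * (Ap - Am) ≤ s₀ * (92 * (n * Δ)) := mul_le_mul_of_nonneg_left hW' hs0p.le
  have hSlo' : s₀ * (141 * (n * Δ)) ≤ s₀ * (Am + Ap) := mul_le_mul_of_nonneg_left hSlo hs0p.le
  have hShi' : s₀ * (Am + Ap) ≤ s₀ * (251 * (n * Δ)) := mul_le_mul_of_nonneg_left hShi hs0p.le
  have hKs : 100 * (s₀ * (n * Δ)) ≤ K * (s₀ * (n * Δ)) := mul_le_mul_of_nonneg_right hK (by positivity)
  refine ⟨?_, ?_, ?_, ?_, ?_⟩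
  · -- width
    have key : n * Δ * (Fp + 1 - Fm) < n * Δ * (152 * s₀ - 2) := by linarith
    have := lt_of_mul_lt_mul_left key hnΔ.le
    linarith
  · have key : n * Δ * (-1) < n * Δ * (Fm + Fp) := by linarith
    have := lt_of_mul_lt_mul_left key hnΔ.le
    linarith
  · have key : n * Δ * (Fm + Fp) ≤ n * Δ * (251 * s₀) := by linarith
    have := le_of_mul_le_mul_left key hnΔ
    linarith
  · have key : n * Δ * (-(2 * K * s₀)) < n * Δ * Fm := by linarith
    have := lt_of_mul_lt_mul_left key hnΔ.le
    linarith
  · have key : n * Δ * (Fp + 1) ≤ n * Δ * (2 * K * s₀) := by linarith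
    exact le_of_mul_le_mul_left key hnΔ

end NegB

end PlanarSkeletonFrm

end Summit.CriticalPhenomena.PercolationContinuityZ3.Theorems.Transplant
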